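import Literature.NumberTheory.EllipticCurves.LocalLayerValuationBoundProofs
import Literature.NumberTheory.EllipticCurves.CyclotomicTowerLocalFrobeniusProofs
import HarnessLib

/-!
# The value group of the fixed field of a layer subgroup `H_{v,n} ≤ Γ_{K_v}` lies in `|π|^ℤ`

`Proofs` file (theorems only: **no definition, no named fact, nothing asserted**) in topic
`NumberTheory/EllipticCurves`, sequel of `LocalLayerValuationBoundProofs` (the bound `|x| ≤ |π|`
below `1` on the fixed field of `H_{v,n}`, by the norm to the inertia-fixed field). Step (1) of
the route to the Kummer count (C1ₙ) of Greenberg's Lemma 3.4 at the layers `n ≥ 1` (R. Greenberg,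
LNM 1716 (1999), §3 Lemma 3.4, p. 89; §2 Prop. 2.2, p. 73 — the twisted Kummer count over the
RAMIFIED layer `(K_n)_v` needs "`π` is a uniformiser of `(K_n)_v`", i.e. `|(K_n)_v^×| = |π|^ℤ`):

* `exists_forall_smul_eq_and_spectralValuation_eq_pow` — **the norm to the base**: for `H ⊴ Γ_{K_v}`,
  `σ₀^N ∈ H`, `Γ_{K_v} = ⋃ σ₀^a H` and `x` fixed by `H`, the element `y = ∏_{j mod N} σ₀^j x` is
  fixed by ALL of `Γ_{K_v}` and `|y| = |x|^N` (the construction inside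
  `spectralValuation_pow_le_of_forall_smul_eq`, exposed).
* `exists_spectralValuation_eq_zpow_of_forall_mem_localSubgroup_smul_eq` — **`|x| ∈ |π|^ℤ` for every
  non-zero `x ∈ K̄_v` fixed by `H_{v,n}`**, when `v ∣ p` is absolutely unramified, `|π|^d = |p|` and
  `pⁿ ∣ d`: with `N ∣ pⁿ` the order of `Γ_{K_v}/H_{v,n}`
  (`ZpExtension.exists_generator_cosets_localSubgroup`), `|x|^N = |y| = |p|^m`
  (`exists_spectralValuation_eq_zpow_prime_of_forall_inertia`: the values of the inertia field are
  `|p|^ℤ`) `= (|π|^{(d/N) m})^N`, so `|x| = |π|^{(d/N) m}` — no knowledge of the exact local degree is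
  needed.

HONEST FRAMING (cell `bsd-f1-sign2`, WIDTH-5 attach seat `bsd-line-att-p5` g41 on crux
stmt-BirchSwinnertonDyer-22298, lineage successor (i)): local bookkeeping for the successor's
(C1ₙ); closes no item; BSD is not proved by any of this.

## References

* [NeukirchANT1999] J. Neukirch, *Algebraic Number Theory* (1999), Ch. II (7.5), (9.11).
* [GreenbergLNM1716] R. Greenberg, LNM 1716 (1999), §3 p. 87, Lemma 3.4 (p. 89).

## Design

No definitions, no named facts; `noncomputable section`; one universe `u`; the product is indexed by
`ZMod N` as in the parent file. Axioms: `propext`, `Classical.choice`, `Quot.sound`.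
-/

noncomputable section

open scoped Classical NNReal
open NumberField IsDedekindDomain

universe u

namespace IsDedekindDomain.HeightOneSpectrum

open Literature.NumberTheory.EllipticCurves Literature.NumberTheory.GaloisRepresentations Field

variable {K : Type u} [Field K] [NumberField K] {v : HeightOneSpectrum (𝓞 K)}
  {p : ℕ} [hp : Fact p.Prime] (hpv : (p : 𝓞 K) ∈ v.asIdeal)
  {w : Valuation (AlgebraicClosure (v.adicCompletion K)) ℝ≥0}
  (hw : ∀ x, (w x : ℝ) = spectralNorm (v.adicCompletion K) (AlgebraicClosure (v.adicCompletion K)) x)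

/-- Powers of `σ₀` act on an `H`-fixed element only through the exponent modulo `N`, when
`σ₀^N ∈ H`. [folklore] -/
private theorem pow_smul_eq_pow_mod_smul' {H : Subgroup (absoluteGaloisGroup (v.adicCompletion K))}
    {σ₀ : absoluteGaloisGroup (v.adicCompletion K)} {N : ℕ} (hσN : σ₀ ^ N ∈ H)
    {x : AlgebraicClosure (v.adicCompletion K)} (hx : ∀ σ ∈ H, σ • x = x) (m : ℕ) :
    σ₀ ^ m • x = σ₀ ^ (m % N) • x := by
  conv_lhs => rw [← Nat.mod_add_div m N, pow_add, pow_mul, mul_smul, hx _ (H.pow_mem hσN _)]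

omit hp in
include hw in
/-- **The norm to the base of an `H`-fixed element.** Let `H ⊴ Γ_{K_v}`, `σ₀ ∈ Γ_{K_v}`, `N ≥ 1` with
`σ₀^N ∈ H` and every `τ ∈ Γ_{K_v}` of the form `σ₀^a h` (`h ∈ H`). For `x ∈ K̄_v` fixed by `H` there
is `y ∈ K̄_v` fixed by every `τ ∈ Γ_{K_v}` with `|y| = |x|^N` (namely `y = ∏_{j mod N} σ₀^j x`).
[cite: NeukirchANT1999, Ch. II Prop. (9.11)] -/
theorem exists_forall_smul_eq_and_spectralValuation_eq_pow
    (H : Subgroup (absoluteGaloisGroup (v.adicCompletion K))) [hH : H.Normal]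
    {σ₀ : absoluteGaloisGroup (v.adicCompletion K)} {N : ℕ} (hN : 0 < N) (hσN : σ₀ ^ N ∈ H)
    (hcos : ∀ τ : absoluteGaloisGroup (v.adicCompletion K), ∃ (a : ℕ) (h : absoluteGaloisGroup
      (v.adicCompletion K)), h ∈ H ∧ τ = σ₀ ^ a * h)
    {x : AlgebraicClosure (v.adicCompletion K)} (hx : ∀ σ ∈ H, σ • x = x) :
    ∃ y : AlgebraicClosure (v.adicCompletion K),
      (∀ τ : absoluteGaloisGroup (v.adicCompletion K), τ • y = y) ∧ w y = w x ^ N := by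
  haveI : NeZero N := ⟨hN.ne'⟩
  refine ⟨∏ j : ZMod N, σ₀ ^ (j.val) • x, fun τ ↦ ?_, ?_⟩
  · have hmove : ∀ (a j : ℕ) (h : absoluteGaloisGroup (v.adicCompletion K)), h ∈ H →
        (σ₀ ^ a * h) • (σ₀ ^ j • x) = σ₀ ^ ((a + j) % N) • x := by
      intro a j h hh
      have hconj : (σ₀ ^ j)⁻¹ * h * σ₀ ^ j ∈ H := by
        have := hH.conj_mem h hh (σ₀ ^ j)⁻¹
        rwa [inv_inv] at this
      calc (σ₀ ^ a * h) • (σ₀ ^ j • x)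
          = (σ₀ ^ a * σ₀ ^ j) • (((σ₀ ^ j)⁻¹ * h * σ₀ ^ j) • x) := by
            rw [← mul_smul, ← mul_smul]; congr 1; group
        _ = σ₀ ^ (a + j) • x := by rw [hx _ hconj, pow_add]
        _ = σ₀ ^ ((a + j) % N) • x := pow_smul_eq_pow_mod_smul' hσN hx _
    obtain ⟨a, h, hh, rfl⟩ := hcos τ
    rw [Finset.smul_prod']
    calc ∏ j : ZMod N, (σ₀ ^ a * h) • (σ₀ ^ (j.val) • x)
        = ∏ j : ZMod N, σ₀ ^ ((j + (a : ZMod N)).val) • x := by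
          refine Finset.prod_congr rfl fun j _ ↦ ?_
          rw [hmove a j.val h hh, ZMod.val_add, ZMod.val_natCast, add_comm, Nat.add_mod_mod]
      _ = ∏ j : ZMod N, σ₀ ^ (j.val) • x :=
          Fintype.prod_equiv (Equiv.addRight (a : ZMod N)) _ _ fun _ ↦ rfl
  · rw [map_prod, Finset.prod_congr rfl fun j _ ↦ spectralValuation_smul hw (σ₀ ^ (j.val)) x,
      Finset.prod_const, Finset.card_univ, ZMod.card]

include hpv hw in
/-- **The values of the fixed field of `H_{v,n}` lie in `|π|^ℤ`.** Let `v ∣ p` with `p` a uniformiser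
of `K_v`, `κ` a `ℤ_p`-extension of `K`, `n ≥ 0`, and `π ∈ K̄_v` with `|π|^d = |p|`, `pⁿ ∣ d`. Then
every non-zero `x ∈ K̄_v` fixed by `H_{v,n} = (Γ_{K_v} → Γ_K)⁻¹(κ⁻¹(pⁿℤ_p))` has `|x| = |π|^m` for
some `m ∈ ℤ`: with `Γ_{K_v} = ⋃_{a<N} σ₀^a H_{v,n}`, `N ∣ pⁿ`
(`ZpExtension.exists_generator_cosets_localSubgroup`), the norm `y` of
`exists_forall_smul_eq_and_spectralValuation_eq_pow` is fixed by the inertia group, so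
`|x|^N = |y| = |p|^{m'}` (`exists_spectralValuation_eq_zpow_prime_of_forall_inertia`)
`= (|π|^{(d/N) m'})^N`, whence `|x| = |π|^{(d/N) m'}`. For the cyclotomic tower over `ℚ` and `π_n`
with `|π_n|^{pⁿ} = |p|` this says: `π_n` is a uniformiser of `(ℚ_n)_p` up to the (unknown here)
index `pⁿ/N`. [cite: NeukirchANT1999, Ch. II Prop. (7.5) with Prop. (9.11)] -/
theorem exists_spectralValuation_eq_zpow_of_forall_mem_localSubgroup_smul_eq
    {𝔐 : Ideal (localAbsIntegers v)} (h𝔐 : 𝔐 ∈ v.localPrimesAbove)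
    (hϖ : Irreducible ((p : ℕ) : v.adicCompletionIntegers K))
    (κ : ZpExtension K p) (n : ℕ) {d : ℕ} (hdn : p ^ n ∣ d)
    {π : AlgebraicClosure (v.adicCompletion K)}
    (hπ : w π ^ d = w (p : AlgebraicClosure (v.adicCompletion K)))
    {x : AlgebraicClosure (v.adicCompletion K)}
    (hx : ∀ σ ∈ localSubgroup (κ.layerSubgroup n) (v.adicCompletion K), σ • x = x) (hx0 : x ≠ 0) :
    ∃ m : ℤ, w x = w π ^ m := by
  obtain ⟨σ₀, N, hN, hNdvd, hσN, hcos⟩ :=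
    ZpExtension.exists_generator_cosets_localSubgroup κ (v.adicCompletion K) n
  obtain ⟨y, hy, hyval⟩ := exists_forall_smul_eq_and_spectralValuation_eq_pow hw
    (localSubgroup (κ.layerSubgroup n) (v.adicCompletion K)) hN hσN
    (fun τ ↦ by obtain ⟨a, h, -, hh, he⟩ := hcos τ; exact ⟨a, h, hh, he⟩) hx
  have hx0' : w x ≠ 0 := (Valuation.ne_zero_iff w).mpr hx0
  have hy0 : y ≠ 0 := fun h ↦ by
    rw [h, map_zero] at hyval
    exact pow_ne_zero N hx0' hyval.symm
  obtain ⟨m', hm'⟩ := exists_spectralValuation_eq_zpow_prime_of_forall_inertia hw h𝔐 hpv hϖ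
    (𝔐 := 𝔐) (fun σ _ ↦ hy σ) hy0
  -- `d = N c`
  obtain ⟨c, hc⟩ := hNdvd.trans hdn
  refine ⟨(c : ℤ) * m', ?_⟩
  -- `|x|^N = |p|^{m'} = ((|π|^c)^{m'})^N`
  have h1 : w x ^ N = ((w π ^ c) ^ m') ^ N := by
    rw [← hyval, hm', ← hπ, hc, mul_comm N c, pow_mul]
    rw [← zpow_natCast ((w π ^ c) ^ m') N, ← zpow_mul, mul_comm m' (N : ℤ), zpow_mul, zpow_natCast]
  have h2 : w x = (w π ^ c) ^ m' := (pow_left_inj₀ zero_le zero_le hN.ne').mp h1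
  rw [h2, zpow_mul, zpow_natCast]

end IsDedekindDomain.HeightOneSpectrum
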